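import Literature.NumberTheory.GaloisCohomology.Howard2004.DVRLevelRaisingInjectiveProofs
import HarnessLib

/-!
# Howard 2004, Theorem 1.6.1 — the CLOSING ARGUMENT, steps 2–3: «`ε = 1`» and the uniform exponent are DERIVED
# (arXiv:1202.6340, p. 11 L33–38 and p. 12 L29–46) — proofs file

Source: B. Howard, *The Heegner point Kolyvagin system*, Compositio Math. **140** (2004) 1439–1472,
Thm. 1.6.1 (= arXiv:1202.6340 Thm. 2.6.1, p. 11 L23–28; proof p. 12 L29–55).  The theorem is the
CITE-ONLY named fact `thm161_dvrKolyvaginBound` (`Howard2004/DVRKolyvaginBound.lean`; consumers: the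
μ-crux `MuInequalityCoherentPair` of PrintX9 / PrintX10b, binder `stub_h161`).  Sequel to
`DVRKolyvaginBoundProofs.lean` (§A–§I), whose §H/§I derive conclusions (i) and (iii) of
`DVRSetting.Conclusion` from the printed inputs taken in an ALREADY SPECIALISED form: there the
structure of Thm. 1.4.2 is assumed with `ε = 1` («`H¹_F(K, T^{(k)}) ≅ R/𝔪^{e_k} ⊕ M_k ⊕ M_k`») and with
ONE exponent `c` killing every `M_k` («`π^c M_k = 0`»).  In print both are CONCLUSIONS of the closing
argument, and THIS FILE derives them, so that the levelwise package enters in its honest printed shape: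

* the package [p. 11 L33–38, with Thm. 1.4.2 = arXiv Thm. 2.4.2 p. 8 and Prop. 1.5.5 = arXiv
  Prop. 2.5.5 p. 10]: «for `ℓ ∈ 𝓝^{(k)}` we have a decomposition
  `H¹_{F(n)}(K, T^{(k)}) ≅ R^{(k),ε} ⊕ M^{(k)}(n) ⊕ M^{(k)}(n)` in which `ε ∈ {0,1}` is independent of
  both `n` and `k`» — typed at `n = 1` as ONE natural number `ε ≤ 1` and, at every level `k`, a finite
  `R`-module `M_k` with an additive `R`-equivariant bijection
  `θ_k : H¹_F(K, T^{(k)}) ≃ (Fin ε → R/𝔪^{e_k}) × (M_k × M_k)`;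
* Lemma 1.6.4 at `n = 1` [arXiv Lemma 2.6.4, p. 11 L60]: «`κ_1^{(k)} ∈ Stub^{(k)} = 𝔪^{λ^{(k)}}
  H¹_F(K, T^{(k)})`, `λ^{(k)} = len_R M^{(k)}`» — typed, as in §I, as `κ_1^{(k)} = π^{len M_k} · y` for a
  Selmer class `y`;
* Lemma 1.3.3 in the part §H uses (`H¹(inc)` carries `H¹_F(K, T^{(k)})` injectively into
  `H¹_F(K, T^{(k+1)})`), unchanged.

What is PROVED here (sorry-free, no new named fact):

* §1 «in particular `Stub^{(k)} ≠ 0`» forces `ε = 1` [p. 12 L31–34]: `κ_1^{(k)} ≠ 0` for `k ≫ 0` (§A),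
  `κ_1^{(k)} = π^{len M_k} y`, and for `ε = 0` the element `π^{len M_k} · θ_k(y)` of
  `R^{(k),0} ⊕ M_k ⊕ M_k` vanishes (§B) — `DVRSetting.epsilon_eq_one_of_package`;
* §2 the lengths `len M_k` are UNIFORMLY bounded [p. 12 L29–31 with L42–43 «`len_R(M^{(k)}) < k`»]:
  reducing `κ_1^{(k')} = π^{len M_{k'}} y'` from level `k' ≥ k₀` down to level `k₀` gives
  `κ_1^{(k₀)} = π^{len M_{k'}} · red(y')`, which is `0` unless `len M_{k'} < e_{k₀}`; hence
  `π^{e_{k₀}}` kills every `M_{k'}` (for `k' < k₀` because `π^{e_{k'}}` already kills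
  `H¹(K, T^{(k')}) ⊇ M_{k'} ⊕ M_{k'}`) — `DVRSetting.toNat_length_lt_of_package`,
  `DVRSetting.pow_e_smul_eq_zero_of_equiv`, `DVRSetting.exists_uniform_exponent_of_package`;
* §3 conclusions (i)+(iii) of `DVRSetting.Conclusion` from the HONEST package —
  `DVRSetting.exists_isFreeRankOneOn_length_le_of_package` (= §I with `ε = 1` and `c` derived);
* §4 the same with the «Lemma 1.3.3 part» discharged by `DVRLevelRaisingInjectiveProofs`
  (`DVRSetting.incH1_mem_selmerGroup`, `DVRSetting.incH1_injective`) —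
  `DVRSetting.exists_isFreeRankOneOn_length_le_of_package'`: (i)+(iii) MODULO ONLY Thm. 1.4.2 /
  Prop. 1.5.5 (printed shape) and Lemma 1.6.4 at `n = 1`.

HONEST FRAMING: `thm161_dvrKolyvaginBound` is NOT proved here: conclusion (ii)
(`H¹_F(K, A) ≅ 𝒟 ⊕ M ⊕ M`) and the three printed inputs (Lemma 1.3.3, Thm. 1.4.2 / Prop. 1.5.5,
Lemma 1.6.4) remain.  No summit statement is proved; the Birch–Swinnerton-Dyer conjecture is not proved
by any of this.  No `sorry`, no new axiom, no instance, no notation, no definition, no named fact.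
-/

set_option autoImplicit false

noncomputable section

open Function NumberField IsDedekindDomain Field
open scoped NumberField ContRepresentation Classical

namespace Literature.NumberTheory.GaloisCohomology.Howard2004

open Literature.NumberTheory.GaloisRepresentations
open Literature.NumberTheory.GaloisRepresentations.DiscreteGaloisModule

namespace DVRSetting

variable {p : ℕ} [Fact p.Prime] {K : Type} [Field K] [NumberField K]
  {R : Type} [CommRing R] [IsDomain R] [IsDiscreteValuationRing R] [Algebra ℤ_[p] R]
  {N : ℕ → Type} [∀ k, AddCommGroup (N k)] [∀ k, TopologicalSpace (N k)]
  [∀ k, DiscreteTopology (N k)] [∀ k, Module R (N k)]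
  {Rk : ℕ → Type} [∀ k, CommRing (Rk k)] [∀ k, IsLocalRing (Rk k)] [∀ k, TopologicalSpace (Rk k)]
  [∀ k, DiscreteTopology (Rk k)] [∀ k, Algebra ℤ_[p] (Rk k)] [∀ k, Algebra R (Rk k)]
  [∀ k, Module (Rk k) (N k)] [∀ k, IsScalarTower R (Rk k) (N k)]
  {Nbar : Type} [AddCommGroup Nbar] [TopologicalSpace Nbar] [DiscreteTopology Nbar]
  [∀ k, Module (Rk k) Nbar]
  {Nq : ℕ → Finset (HeightOneSpectrum (𝓞 K)) → Type} [∀ k n, AddCommGroup (Nq k n)]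
  [∀ k n, TopologicalSpace (Nq k n)] [∀ k n, DiscreteTopology (Nq k n)]
  [∀ k n, Module (Rk k) (Nq k n)] [∀ k n, Module R (Nq k n)]
  [∀ k n, IsScalarTower R (Rk k) (Nq k n)]

/-! ## §0 Two facts about the levels used throughout -/

/-- The uniformizer lies in `𝔪` (`𝔪 = (π)`, `SatisfiesH.unif`).
[cite: Howard2004HeegnerKolyvagin, §1.6 (arXiv p. 11, L13–14)] -/
theorem pi_mem_maximalIdeal (S : DVRSetting p K R N Rk Nbar Nq) (hy : S.SatisfiesH) :
    S.π ∈ IsLocalRing.maximalIdeal R := by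
  rw [hy.unif]; exact Ideal.mem_span_singleton_self _

/-- `π^a` kills `H¹(K, T^{(k)})` as soon as `e_k ≤ a` (level `k` is `T/𝔪^{e_k}`, `SatisfiesH.killed`,
and a scalar killing the module kills its `H¹`).
[cite: Howard2004HeegnerKolyvagin, §1.6 (arXiv p. 11 L33–35; p. 12 L29–31)] -/
theorem scalarMapH1_pow_eq_zero_of_le (S : DVRSetting p K R N Rk Nbar Nq) (hy : S.SatisfiesH)
    (k : ℕ) {a : ℕ} (ha : S.e k ≤ a) (h : galoisCohomology (S.T.ρ k) 1) :
    galoisCohomology.scalarMapH1 (S.T.ρ k) (S.T.hlin k) (S.π ^ a) h = 0 := by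
  letI : Module R (galoisCohomology (S.T.ρ k) 1) := galoisCohomology.moduleH1 (S.T.ρ k) (S.T.hlin k)
  have hkill : S.π ^ S.e k • h = 0 :=
    galoisCohomology.smul_eq_zero_of_forall (S.T.ρ k) (S.T.hlin k) _
      (fun m => hy.killed k _ (Ideal.pow_mem_pow (S.pi_mem_maximalIdeal hy) _) m) h
  change S.π ^ a • h = 0
  rw [← Nat.sub_add_cancel ha, pow_add, mul_smul, hkill, smul_zero]

/-! ## §1 «in particular `Stub^{(k)} ≠ 0`»: the package's `ε ∈ {0, 1}` is `1` (p. 12 L31–34) -/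

/-- **Step 2 of the closing argument of Thm. 1.6.1: `ε = 1`.**  With the levelwise structure of
Thm. 1.4.2 / Prop. 1.5.5 in its printed shape — ONE `ε ≤ 1` («`ε ∈ {0,1}` is independent of both `n`
and `k`») and additive `R`-equivariant bijections `θ_k : H¹_F(K, T^{(k)}) ≃ R^{(k),ε} ⊕ M_k ⊕ M_k`,
`R^{(k),ε} = (Fin ε → R/𝔪^{e_k})`, `M_k` finite — and Lemma 1.6.4 at `n = 1`
(`κ_1^{(k)} = π^{len M_k} · y_k`, `y_k` Selmer), a Kolyvagin system with `κ_1 ≠ 0` forces `ε = 1`: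
«we must have `κ_1^{(k)}` nonzero for `k ≫ 0` … `κ_1^{(k)} ∈ Stub^{(k)}`, and in particular
`Stub^{(k)} ≠ 0`», while for `ε = 0` the stub `𝔪^{len M_k}(M_k ⊕ M_k)` vanishes (§B).
[cite: Howard2004HeegnerKolyvagin, Thm. 1.6.1, proof (arXiv p. 11 L33–38; p. 12 L29–34)] -/
theorem epsilon_eq_one_of_package (S : DVRSetting p K R N Rk Nbar Nq) (κ : S.KolyvaginSystem)
    (hy : S.SatisfiesH) {ε : ℕ} (hε : ε ≤ 1)
    {M : ℕ → Type} [∀ k, AddCommGroup (M k)] [∀ k, Module R (M k)] [∀ k, Finite (M k)]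
    (θ : ∀ k, ↥(((S.t k).cond).selmerGroup) ≃+
      ((Fin ε → R ⧸ IsLocalRing.maximalIdeal R ^ S.e k) × (M k × M k)))
    (hθ : ∀ k (r : R) (y : galoisCohomology (S.T.ρ k) 1) (hy' : y ∈ ((S.t k).cond).selmerGroup),
      θ k ⟨galoisCohomology.scalarMapH1 (S.T.ρ k) (S.T.hlin k) r y,
          S.scalarMapH1_mem_selmerGroup hy k r hy'⟩ = r • θ k ⟨y, hy'⟩)
    (h164 : ∀ k, ∃ y ∈ ((S.t k).cond).selmerGroup,
      κ.one k = galoisCohomology.scalarMapH1 (S.T.ρ k) (S.T.hlin k)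
        (S.π ^ (Module.length R (M k)).toNat) y)
    (hone : κ.one ≠ 0) : ε = 1 := by
  obtain ⟨k₀, hk₀⟩ := κ.exists_forall_le_one_apply_ne_zero hone
  by_contra hne
  have hε0 : ε = 0 := by omega
  subst hε0
  obtain ⟨y, hy', h1⟩ := h164 k₀
  haveI : IsArtinian R (M k₀) := isArtinian_of_finite
  have hr : S.π ^ (Module.length R (M k₀)).toNat ∈
      IsLocalRing.maximalIdeal R ^ (Module.length R (M k₀)).toNat :=
    Ideal.pow_mem_pow (S.pi_mem_maximalIdeal hy) _
  -- in `R^{(k₀),0} ⊕ M ⊕ M` the element `π^{len M} · θ(y)` vanishes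
  have hzero : θ k₀ ⟨galoisCohomology.scalarMapH1 (S.T.ρ k₀) (S.T.hlin k₀)
      (S.π ^ (Module.length R (M k₀)).toNat) y, S.scalarMapH1_mem_selmerGroup hy k₀ _ hy'⟩ = 0 := by
    rw [hθ k₀ _ y hy']
    exact stub_subsingleton_of_free_part_subsingleton hr _
  apply hk₀ k₀ le_rfl
  rw [h1]
  have h := (θ k₀).map_eq_zero_iff.mp hzero
  exact congrArg Subtype.val h

/-! ## §2 The lengths `len_R M_k` are uniformly bounded (p. 12 L29–31, L42–43) -/

/-- Reducing a hypothetical identity `κ_1^{(k₀+d)} = π^a · y` down the tower to level `k₀` (the level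
classes `κ_1^{(k)}` are compatible under the reductions, which commute with the scalars) gives
`κ_1^{(k₀)} = π^a · red(y) = 0` once `e_{k₀} ≤ a` — impossible when `κ_1^{(k₀)} ≠ 0`.
[cite: Howard2004HeegnerKolyvagin, Thm. 1.6.1, proof (arXiv p. 12, L29–31)] -/
theorem one_ne_scalarMapH1_pow_of_le (S : DVRSetting p K R N Rk Nbar Nq) (κ : S.KolyvaginSystem)
    (hy : S.SatisfiesH) {k₀ : ℕ} (hk₀ : κ.one k₀ ≠ 0) {a : ℕ} (ha : S.e k₀ ≤ a) :
    ∀ (d : ℕ) (y : galoisCohomology (S.T.ρ (k₀ + d)) 1),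
      κ.one (k₀ + d) ≠ galoisCohomology.scalarMapH1 (S.T.ρ (k₀ + d)) (S.T.hlin (k₀ + d)) (S.π ^ a) y := by
  intro d
  induction d with
  | zero =>
    intro y h
    exact hk₀ (h.trans (S.scalarMapH1_pow_eq_zero_of_le hy (k₀ + 0) ha y))
  | succ d ih =>
    intro y h
    refine ih (S.T.redH1 (k₀ + d) y) ?_
    rw [← κ.redH1_one (k₀ + d), ← AdicTower.redH1_scalarMapH1]
    exact congrArg _ h

/-- **`len_R M_{k} < e_{k₀}` for every `k ≥ k₀`**, `k₀` a level from which on `κ_1^{(k)} ≠ 0`: by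
Lemma 1.6.4 at `n = 1`, `κ_1^{(k)} = π^{len M_k} · y`, and its reduction `κ_1^{(k₀)} = π^{len M_k} · red(y)`
is non-zero.  (Print, with `e_k = k` and `k₀ = k`: «`len_R(M^{(k)}) < k`».)
[cite: Howard2004HeegnerKolyvagin, Thm. 1.6.1, proof (arXiv p. 12, L29–31 and L42–43)] -/
theorem toNat_length_lt_of_package (S : DVRSetting p K R N Rk Nbar Nq) (κ : S.KolyvaginSystem)
    (hy : S.SatisfiesH) {M : ℕ → Type} [∀ k, AddCommGroup (M k)] [∀ k, Module R (M k)]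
    (h164 : ∀ k, ∃ y ∈ ((S.t k).cond).selmerGroup,
      κ.one k = galoisCohomology.scalarMapH1 (S.T.ρ k) (S.T.hlin k)
        (S.π ^ (Module.length R (M k)).toNat) y)
    {k₀ : ℕ} (hk₀ : κ.one k₀ ≠ 0) {k : ℕ} (hk : k₀ ≤ k) :
    (Module.length R (M k)).toNat < S.e k₀ := by
  obtain ⟨d, rfl⟩ := Nat.exists_eq_add_of_le hk
  by_contra hlt
  push Not at hlt
  obtain ⟨y, -, h1⟩ := h164 (k₀ + d)
  exact S.one_ne_scalarMapH1_pow_of_le κ hy hk₀ hlt d y h1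

/-- `π^{e_k}` kills `M_k`: `M_k ⊕ M_k` sits inside `H¹_F(K, T^{(k)})` through the `R`-equivariant
bijection `θ_k`, and `π^{e_k}` kills `H¹(K, T^{(k)})`.
[cite: Howard2004HeegnerKolyvagin, Thm. 1.6.1, proof (arXiv p. 11 L33–38; p. 12 L40–43)] -/
theorem pow_e_smul_eq_zero_of_equiv (S : DVRSetting p K R N Rk Nbar Nq) (hy : S.SatisfiesH)
    {E : ℕ → Type} [∀ k, AddCommGroup (E k)] [∀ k, Module R (E k)]
    {M : ℕ → Type} [∀ k, AddCommGroup (M k)] [∀ k, Module R (M k)]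
    (θ : ∀ k, ↥(((S.t k).cond).selmerGroup) ≃+ (E k × (M k × M k)))
    (hθ : ∀ k (r : R) (y : galoisCohomology (S.T.ρ k) 1) (hy' : y ∈ ((S.t k).cond).selmerGroup),
      θ k ⟨galoisCohomology.scalarMapH1 (S.T.ρ k) (S.T.hlin k) r y,
          S.scalarMapH1_mem_selmerGroup hy k r hy'⟩ = r • θ k ⟨y, hy'⟩)
    (k : ℕ) (m : M k) : S.π ^ S.e k • m = 0 := by
  set z : ↥(((S.t k).cond).selmerGroup) := (θ k).symm (0, (m, 0)) with hz
  have h1 : S.π ^ S.e k • θ k z = 0 := by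
    have h2 := hθ k (S.π ^ S.e k) z.1 z.2
    have h3 : (⟨galoisCohomology.scalarMapH1 (S.T.ρ k) (S.T.hlin k) (S.π ^ S.e k) z.1,
        S.scalarMapH1_mem_selmerGroup hy k _ z.2⟩ : ↥(((S.t k).cond).selmerGroup)) = 0 :=
      Subtype.ext (S.scalarMapH1_pow_eq_zero_of_le hy k le_rfl z.1)
    rw [h3, map_zero] at h2
    exact h2.symm
  rw [hz, AddEquiv.apply_symm_apply, Prod.smul_mk, Prod.smul_mk, Prod.mk_eq_zero, Prod.mk_eq_zero] at h1
  exact h1.2.1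

/-- **Step 3 of the closing argument: ONE exponent kills every `M_k`.**  `π^{e_{k₀}} M_k = 0` for all
`k`: for `k ≥ k₀` because `len M_k < e_{k₀}` (`toNat_length_lt_of_package`) and `𝔪^{len M} M = 0` (§B);
for `k < k₀` because `π^{e_k}` kills `M_k` (`pow_e_smul_eq_zero_of_equiv`) and `e_k ≤ e_{k₀}`.
[cite: Howard2004HeegnerKolyvagin, Thm. 1.6.1, proof (arXiv p. 12, L29–31 and L40–46)] -/
theorem exists_uniform_exponent_of_package (S : DVRSetting p K R N Rk Nbar Nq)
    (κ : S.KolyvaginSystem) (hy : S.SatisfiesH)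
    {E : ℕ → Type} [∀ k, AddCommGroup (E k)] [∀ k, Module R (E k)]
    {M : ℕ → Type} [∀ k, AddCommGroup (M k)] [∀ k, Module R (M k)] [∀ k, Finite (M k)]
    (θ : ∀ k, ↥(((S.t k).cond).selmerGroup) ≃+ (E k × (M k × M k)))
    (hθ : ∀ k (r : R) (y : galoisCohomology (S.T.ρ k) 1) (hy' : y ∈ ((S.t k).cond).selmerGroup),
      θ k ⟨galoisCohomology.scalarMapH1 (S.T.ρ k) (S.T.hlin k) r y,
          S.scalarMapH1_mem_selmerGroup hy k r hy'⟩ = r • θ k ⟨y, hy'⟩)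
    (h164 : ∀ k, ∃ y ∈ ((S.t k).cond).selmerGroup,
      κ.one k = galoisCohomology.scalarMapH1 (S.T.ρ k) (S.T.hlin k)
        (S.π ^ (Module.length R (M k)).toNat) y)
    (hone : κ.one ≠ 0) :
    ∃ c : ℕ, ∀ (k : ℕ) (m : M k), S.π ^ c • m = 0 := by
  obtain ⟨k₀, hk₀⟩ := κ.exists_forall_le_one_apply_ne_zero hone
  refine ⟨S.e k₀, fun k m => ?_⟩
  by_cases hk : k₀ ≤ k
  · -- `len M_k < e_{k₀}`, and `𝔪^{e_{k₀}} M_k = 0` by §B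
    haveI : IsArtinian R (M k) := isArtinian_of_finite
    have hlt := S.toNat_length_lt_of_package κ hy h164 (hk₀ k₀ le_rfl) hk
    have hle : Module.length R (↥(⊤ : Submodule R (M k))) ≤ S.e k₀ := by
      rw [Submodule.topEquiv.length_eq, ← ENat.coe_toNat (Module.length_ne_top (R := R) (M := M k))]
      exact_mod_cast hlt.le
    have h := maximalIdeal_pow_smul_eq_bot_of_length_le (R := R) (M := M k) (S.e k₀) ⊤ hle
    rw [Submodule.eq_bot_iff] at h
    exact h _ (Submodule.smul_mem_smul (Ideal.pow_mem_pow (S.pi_mem_maximalIdeal hy) _)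
      Submodule.mem_top)
  · -- `k < k₀`: `π^{e_k}` kills `M_k` and `e_k ≤ e_{k₀}`
    push Not at hk
    have hle : S.e k ≤ S.e k₀ := (hy.e_strictMono hk).le
    rw [← Nat.sub_add_cancel hle, pow_add, mul_smul, S.pow_e_smul_eq_zero_of_equiv hy θ hθ k m,
      smul_zero]

/-! ## §3 Conclusions (i) and (iii) of Thm. 1.6.1 from the HONEST levelwise package (p. 12 L29–55) -/

/-- **Thm. 1.6.1, conclusions (i) («`H¹_F(K, T)` is free of rank one over `R`») and (iii) (the length
bound, on the level structure modules) from the printed inputs in their printed shape**: on a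
`DVRSetting` with H.0–H.5 and a Kolyvagin system with `κ_1 ≠ 0`, GIVEN (a) Lemma 1.3.3 in the part used
(`H¹(inc)` carries `H¹_F(K, T^{(k)})` injectively into `H¹_F(K, T^{(k+1)})`), (b) Thm. 1.4.2 / Prop. 1.5.5
levelwise — ONE `ε ≤ 1` and additive `R`-equivariant bijections
`H¹_F(K, T^{(k)}) ≃ (Fin ε → R/𝔪^{e_k}) × (M_k × M_k)` with `M_k` finite — and (c) Lemma 1.6.4 at
`n = 1` (`κ_1^{(k)} = π^{len M_k} · y_k`), THEN there is a generator `x` of the free rank-one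
`H¹_F(K, T) = lim_k H¹_F(K, T^{(k)})` (`IsFreeRankOneOn`) such that for all `k ≫ 0` and every `r₁` with
`κ_1 = r₁ · x`: `len_R M_k ≤ len_R (R ⧸ r₁R)`.  Compared with §I
(`exists_isFreeRankOneOn_length_le_of_printedInputs`) the specialisations «`ε = 1`» (§1) and «one
exponent `c` with `π^c M_k = 0`» (§2) are now DERIVED, as in print.  `thm161_dvrKolyvaginBound` is NOT
proved here (conclusion (ii) `H¹_F(K, A) ≅ 𝒟 ⊕ M ⊕ M` and the three printed inputs remain).
[cite: Howard2004HeegnerKolyvagin, Thm. 1.6.1, proof (arXiv p. 11 L33–38; p. 12 L29–55)] -/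
theorem exists_isFreeRankOneOn_length_le_of_package (S : DVRSetting p K R N Rk Nbar Nq)
    (κ : S.KolyvaginSystem) (hy : S.SatisfiesH) (hπm : S.π ∈ IsLocalRing.maximalIdeal R)
    (hle : ∀ k, S.e k ≤ S.e (k + 1))
    (hFinc : ∀ k, ∀ y ∈ ((S.t k).cond).selmerGroup,
      S.T.incH1 S.π S.e hy.killed hy.ker_red hπm hle k y ∈ ((S.t (k + 1)).cond).selmerGroup)
    (hFinj : ∀ k, ∀ y ∈ ((S.t k).cond).selmerGroup,
      S.T.incH1 S.π S.e hy.killed hy.ker_red hπm hle k y = 0 → y = 0)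
    {ε : ℕ} (hε : ε ≤ 1)
    {M : ℕ → Type} [∀ k, AddCommGroup (M k)] [∀ k, Module R (M k)] [∀ k, Finite (M k)]
    (θ : ∀ k, ↥(((S.t k).cond).selmerGroup) ≃+
      ((Fin ε → R ⧸ IsLocalRing.maximalIdeal R ^ S.e k) × (M k × M k)))
    (hθ : ∀ k (r : R) (y : galoisCohomology (S.T.ρ k) 1) (hy' : y ∈ ((S.t k).cond).selmerGroup),
      θ k ⟨galoisCohomology.scalarMapH1 (S.T.ρ k) (S.T.hlin k) r y,
          S.scalarMapH1_mem_selmerGroup hy k r hy'⟩ = r • θ k ⟨y, hy'⟩)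
    (h164 : ∀ k, ∃ y ∈ ((S.t k).cond).selmerGroup,
      κ.one k = galoisCohomology.scalarMapH1 (S.T.ρ k) (S.T.hlin k)
        (S.π ^ (Module.length R (M k)).toNat) y)
    (hone : κ.one ≠ 0) :
    ∃ x : ∀ k, galoisCohomology (S.T.ρ k) 1,
      S.T.IsFreeRankOneOn (S.T.limitSelmer fun k => (S.t k).cond) x ∧
      ∃ k₀ : ℕ, ∀ k, k₀ ≤ k → ∀ r₁ : R, κ.one = S.T.smulFamily r₁ x →
        Module.length R (M k) ≤ Module.length R (R ⧸ Ideal.span {r₁}) := by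
  -- step 2: `ε = 1`
  have hε1 : ε = 1 := S.epsilon_eq_one_of_package κ hy hε θ hθ h164 hone
  subst hε1
  -- step 3: one exponent kills every `M_k`
  obtain ⟨c, hc⟩ := S.exists_uniform_exponent_of_package κ hy θ hθ h164 hone
  -- `R^{(k),1} = (Fin 1 → R/𝔪^{e_k}) ≅ R/𝔪^{e_k}`, `R`-linearly
  let L : ∀ k, ((Fin 1 → R ⧸ IsLocalRing.maximalIdeal R ^ S.e k) × (M k × M k)) ≃ₗ[R]
      ((R ⧸ IsLocalRing.maximalIdeal R ^ S.e k) × (M k × M k)) := fun k =>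
    (LinearEquiv.funUnique (Fin 1) R _).prodCongr (LinearEquiv.refl R _)
  let θ' : ∀ k, ↥(((S.t k).cond).selmerGroup) ≃+
      ((R ⧸ IsLocalRing.maximalIdeal R ^ S.e k) × (M k × M k)) := fun k =>
    (θ k).trans (L k).toAddEquiv
  have hθ' : ∀ k (r : R) (y : galoisCohomology (S.T.ρ k) 1) (hy' : y ∈ ((S.t k).cond).selmerGroup),
      θ' k ⟨galoisCohomology.scalarMapH1 (S.T.ρ k) (S.T.hlin k) r y,
          S.scalarMapH1_mem_selmerGroup hy k r hy'⟩ = r • θ' k ⟨y, hy'⟩ := by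
    intro k r y hy'
    change L k (θ k ⟨_, _⟩) = r • L k (θ k ⟨y, hy'⟩)
    rw [hθ k r y hy', LinearEquiv.map_smul]
  exact S.exists_isFreeRankOneOn_length_le_of_printedInputs κ hy hπm hle hFinc hFinj c hc θ' hθ' h164
    hone

/-! ## §4 The same with the «Lemma 1.3.3 part» DISCHARGED (`DVRLevelRaisingInjectiveProofs`) -/

/-- **Thm. 1.6.1, conclusions (i) and (iii), MODULO ONLY the two printed inputs in their printed shape** —
Thm. 1.4.2 / Prop. 1.5.5 levelwise (ONE `ε ≤ 1`, additive `R`-equivariant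
`H¹_F(K, T^{(k)}) ≃ (Fin ε → R/𝔪^{e_k}) × (M_k × M_k)`, `M_k` finite) and Lemma 1.6.4 at `n = 1`
(`κ_1^{(k)} = π^{len M_k} · y_k`) — for a `DVRSetting` with H.0–H.5 and a Kolyvagin system with `κ_1 ≠ 0`:
the «Lemma 1.3.3 part» (`hFinc`, `hFinj`) of `exists_isFreeRankOneOn_length_le_of_package` is supplied by
`DVRSetting.incH1_mem_selmerGroup` / `DVRSetting.incH1_injective` (`DVRLevelRaisingInjectiveProofs`), `π ∈ 𝔪`
and `e_k ≤ e_{k+1}` by `SatisfiesH`; «`ε = 1`» and the uniform exponent are derived (§1–§2).  After this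
the tree's reduction of `thm161_dvrKolyvaginBound` rests on these TWO printed inputs plus conclusion (ii)
and its glue; the fact itself is NOT proved here.
[cite: Howard2004HeegnerKolyvagin, Thm. 1.6.1, proof (arXiv p. 11 L33–38; p. 12 L29–55)] -/
theorem exists_isFreeRankOneOn_length_le_of_package' (S : DVRSetting p K R N Rk Nbar Nq)
    (κ : S.KolyvaginSystem) (hy : S.SatisfiesH) {ε : ℕ} (hε : ε ≤ 1)
    {M : ℕ → Type} [∀ k, AddCommGroup (M k)] [∀ k, Module R (M k)] [∀ k, Finite (M k)]
    (θ : ∀ k, ↥(((S.t k).cond).selmerGroup) ≃+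
      ((Fin ε → R ⧸ IsLocalRing.maximalIdeal R ^ S.e k) × (M k × M k)))
    (hθ : ∀ k (r : R) (y : galoisCohomology (S.T.ρ k) 1) (hy' : y ∈ ((S.t k).cond).selmerGroup),
      θ k ⟨galoisCohomology.scalarMapH1 (S.T.ρ k) (S.T.hlin k) r y,
          S.scalarMapH1_mem_selmerGroup hy k r hy'⟩ = r • θ k ⟨y, hy'⟩)
    (h164 : ∀ k, ∃ y ∈ ((S.t k).cond).selmerGroup,
      κ.one k = galoisCohomology.scalarMapH1 (S.T.ρ k) (S.T.hlin k)
        (S.π ^ (Module.length R (M k)).toNat) y)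
    (hone : κ.one ≠ 0) :
    ∃ x : ∀ k, galoisCohomology (S.T.ρ k) 1,
      S.T.IsFreeRankOneOn (S.T.limitSelmer fun k => (S.t k).cond) x ∧
      ∃ k₀ : ℕ, ∀ k, k₀ ≤ k → ∀ r₁ : R, κ.one = S.T.smulFamily r₁ x →
        Module.length R (M k) ≤ Module.length R (R ⧸ Ideal.span {r₁}) :=
  S.exists_isFreeRankOneOn_length_le_of_package κ hy (S.π_mem_maximalIdeal hy) (S.e_le_succ hy)
    (fun k _ hy' => S.incH1_mem_selmerGroup hy _ _ k hy')
    (fun k y _ h => S.incH1_injective hy _ _ k (by rw [h, map_zero])) hε θ hθ h164 hone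

end DVRSetting

end Literature.NumberTheory.GaloisCohomology.Howard2004
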